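import Summits.ResolutionOfSingularities.ResolutionOfSingularities.Theorems.EquisingularLiftEquisingularLiftNatOneStepVertexChart
import HarnessLib

/-!
# [OURS · L1 W4.5(b)] THE JACOBIAN CRITERION ALONG A RING ISOMORPHISM `K[ι] ≅ A` (polynomial bases `K[u][T] ≅ K[T ⊕ u]`): regularity of `A/(G)` at a
# prime from a partial derivative of `ρ⁻¹G` (crux `Theses.EquisingularLift.EquisingularLiftNat`, stmt-ResolutionOfSingularities-20038)

NOT a statement of any manuscript; OURS kernel lemma (cell `res-hironaka`, chain w45b; seat res-D-pv-013, own initiative, counted 0). AI-written,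
weaker than expert review. No definition, no `sorry`, standard axioms.

`OneStepRel.isRegularLocalRing_localization_blowupAlgebra` (the vertex chart of a one-step point over the base `R = K[u]`) asks for regularity of
`R[T]/(G)` at the primes containing `T̄_a`. Over `R = K[u]` this is the ordinary Jacobian criterion in ALL the variables `T` AND `u`: flatten along
Mathlib's `sumAlgEquiv : K[T ⊕ u] ≃ₐ K[u][T]` and use the tree's pointwise criterion.

* **`OneStepRel.isRegularLocalRing_localization_quotient_of_pderiv_ringEquiv`** — for a ring isomorphism `ρ : K[ι] ≅ A` (e.g. `sumAlgEquiv : K[T ⊕ u] ≅ K[u][T]`),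
  `G ∈ A` and a prime `P̄` of `A/(G)`: if the class of `ρ(∂(ρ⁻¹G)/∂v)` misses `P̄` for some variable `v`, then `(A/(G))_{P̄}` is regular.

References: Matsumura Thm. 14.2 — through the cited tree file (`…Theorems.MvPolynomial.isRegularLocalRing_localization_quotient_of_pderiv_notMem`).
-/

set_option linter.dupNamespace false -- mandated namespace `Summit.<Summit>.<Problem>` of this single-conjunct summit

noncomputable section

namespace Summit.ResolutionOfSingularities.ResolutionOfSingularities.Cruxes.EquisingularLiftNat.Sections

open MvPolynomial IsLocalization IsLocalRing Literature.AlgebraicGeometry.Resolution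

namespace OneStepRel

/-- **Jacobian criterion transported along a ring isomorphism `ρ : K[ι] ≅ A`** (e.g. Mathlib's `sumAlgEquiv : K[T ⊕ u] ≅ K[u][T]`, the case of a
polynomial base): for `G ∈ A` and a prime `P̄` of `A/(G)`, if the class of `ρ(∂(ρ⁻¹G)/∂v)` does not lie in `P̄` for some variable `v : ι`, then
`(A/(G))_{P̄}` is a regular local ring (the tree's pointwise criterion for `K[ι]/(ρ⁻¹G)`, moved along `K[ι]/(ρ⁻¹G) ≅ A/(G)`).
[cite: Matsumura1987, Thm. 14.2] -/
theorem isRegularLocalRing_localization_quotient_of_pderiv_ringEquiv {K : Type} [Field K] {ι : Type} [Finite ι]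
    {A : Type} [CommRing A] (ρ : MvPolynomial ι K ≃+* A) {G : A} (Pbar : Ideal (A ⧸ Ideal.span {G})) [Pbar.IsPrime]
    (v : ι) (hv : Ideal.Quotient.mk (Ideal.span {G}) (ρ (pderiv v (ρ.symm G))) ∉ Pbar) :
    IsRegularLocalRing (Localization.AtPrime Pbar) := by
  classical
  -- `K[ι]/(ρ⁻¹G) ≅ A/(G)`
  have hGflat : Ideal.span {G} = (Ideal.span {ρ.symm G}).map (ρ : MvPolynomial ι K →+* A) := by
    rw [Ideal.map_span, Set.image_singleton]
    exact congrArg (fun b => Ideal.span {b}) (ρ.apply_symm_apply G).symm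
  let η : (MvPolynomial ι K ⧸ Ideal.span {ρ.symm G}) ≃+* (A ⧸ Ideal.span {G}) := Ideal.quotientEquiv _ _ ρ hGflat
  have hη : ∀ q, η (Ideal.Quotient.mk _ q) = Ideal.Quotient.mk _ (ρ q) := fun q => Ideal.quotientEquiv_mk _ _ _ _ q
  obtain ⟨Q, hQ⟩ : ∃ Q : Ideal (MvPolynomial ι K ⧸ Ideal.span {ρ.symm G}), Q = Pbar.comap η.toRingHom := ⟨_, rfl⟩
  haveI : Q.IsPrime := by rw [hQ]; exact Ideal.comap_isPrime _ Pbar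
  have hmem : ∀ q, q ∈ Q ↔ η q ∈ Pbar := fun q => by rw [hQ, Ideal.mem_comap]; rfl
  have hv' : Ideal.Quotient.mk (Ideal.span {ρ.symm G}) (pderiv v (ρ.symm G)) ∉ Q := fun h => hv (by
    have h' := (hmem _).mp h
    rwa [hη] at h')
  have hreg : IsRegularLocalRing (Localization.AtPrime Q) :=
    Summit.ResolutionOfSingularities.ResolutionOfSingularities.Theorems.MvPolynomial.isRegularLocalRing_localization_quotient_of_pderiv_notMem Q v hv'
  exact OrdPoint.isRegularLocalRing_localization_of_ringEquiv η Q Pbar (fun q => (hmem q).symm) hreg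

end OneStepRel

end Summit.ResolutionOfSingularities.ResolutionOfSingularities.Cruxes.EquisingularLiftNat.Sections

end
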